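import Summits.QuantumFields.BalabanUV.Beta.GAN24.FourFaceOneCov

/-!
# `BalabanUV.Beta.GAN24.FourFaceGaugeSectors` — binder row G-an2-4 ∕ (CONV-C), row (C) at the levels `j ≥ 1`, CONTACT side (leaf-06 g52's memo
# `C-LEVELS-GE1.md` §17 (W8) «leaf-02 successor — the contact defect in their `TableDressingZeroMode` currency»; my g62 memo `C-MECHANISM-v0.md` §5c
# «(S-odd) + mixed pairs vanish word by word; the content is the same-direction PAIR identity»): **THE FOUR-FACE CHARGE OF A UNIT-COVARIANT TABLE IN
# PURE-GAUGE SECTORS** — `N⁴·FF_N(Y) = Σ_{S ⊆ {0,1,2,3}} (−1)^{|S|}·Sector_S(Y)`, `Sector_∅ = zmode_N(Y)`, and EVERY SECTOR WITH A LONELY DIRECTION VANISHES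

NOT IN PRINT; OUR BOOKKEEPING (G-an2-4 crux team (2), leaf prover `b2b-balaban-gan24-formalise-leaf-02`, gen 64; journal [LEAF02-G64-ONLINE] ∕ INTENT
I-leaf02-g64-1).  WHY.  p2 g36's one-step charge law of the dressed comb tower in four-face form (`T2RecChargeStepFourFace.zmode_succ_eq_fourFace`:
`zmode N T̃_{j+1} = zmode N b̃_j + λ̂·Lc⁴·(FF_Lc(T̃_j)(μν) + FF_Lc(T̃_j)(νμ))`, over my g52 `TableDressingZeroMode.zmode_tableDress_ff`) makes row (C)_j the
statement that the dressed SOURCE's symmetrised charge compensates the member's four-face EXCESS `Lc⁴·FF_Lc(T̃_j) − zmode_Lc(T̃_j)`.  The exit-face weight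
of one slot is `N·[w_δ % N = N−1] = 1 − (1 − N·[w_δ % N = N−1])`, and `1 − N·[w_δ % N = N−1]` is the `δ`-component of the gradient `dλ_δ` of the zero-mean
block sawtooth — (Z2) `Π_bm c̃_δ = c̃_δ − dλ_δ` (gan24-p4's `PiBmConstants.axProjBmAt_const`) in components.  Expanding the four slots by inclusion–exclusion
writes the excess as the alternating sum of the fifteen PURE-GAUGE SECTORS `Sector_S(Y)` (`∅ ≠ S ⊆ {0,1,2,3}`: the table contracted with `dλ` in the slots
of `S` and with the constants elsewhere) — the currency in which the Ward letters are stated (an2 g48's `WardLocusQuarticSite` for the background slots,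
the kernel-LEG letter for the legs).  THIS FILE proves the expansion for every `LocStencil₂` table whose field–field block is covariant under ALL unit
translations of its lattice (the comb member at every level: its `e4OfKW` part is unit-covariant by an2's `e4OfKW_translate`, the border's field–field
block is `0`), and proves that every sector in which some direction is faced by exactly ONE slot of `S` VANISHES — by separation of variables: moved to the
slice at the origin (unit covariance), the cell correlation of the one-coordinate slot weights factorises over the coordinates, and a lonely coordinate
contributes a window sum `Σ_{m<N} (1 − N·[(m+e) % N = N−1]) = 0`.  So one pure-gauge insertion never charges the table, two insertions in distinct directions
do not, three do not unless their directions coincide: the engine's anatomy of the contact word (memo §5c: one-insertion and mixed-pair sectors `≤ 1e-15` at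
j = 0, `≤ 4e-19` at j = 1) as a theorem at EVERY level, generic `d`, generic pattern; what survives are exactly LAW A's live sectors (for the Wilson-charged
patterns `(κ,κ;a,a)`: the background pair `{0,1}`, the leg pair `{2,3}`, and `{0,1,2,3}`).

WHAT (generic `d`; `Y : Tab d` with `LocStencil₂ Y C δ`, `0 < δ`, and the ff-COVARIANCE `Y κ (u+t) κ′ (u′+t) x z (inl α) (inl β) = shiftK (−t) (Y κ u κ′ u′) x z (inl α) (inl β)`
for ALL unit translations `t` — implied by full unit covariance; [folklore] lattice re-indexing, inclusion–exclusion, `Finset.sum_prod_piFinset`; 0 `def`,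
0 cited facts, 0 `def … : Prop`, 0 sorry):
* §1 `tsum3_weight_shift`, `summable_weight_slice`, **`weighted_eq_tsum_prod`** ∕ **`weighted_eq_cellCorr_slice`** — THE WEIGHTED SLICE FORMULA: for a
  cell-indexed family of weights bounded by `B`, `Σ_{r ∈ box N} Σ'_{u′} Σ'_x Σ'_z w r u′ x z·Y κ r κ′ u′ x z (inl α) (inl β)
  = Σ'_{u′} Σ'_x Σ'_z (Σ_{r ∈ box N} w r (u′+r) (x+r) (z+r))·Y κ 0 κ′ u′ x z (inl α) (inl β)` (my g52 `FourFaceOneCov.fourFace_eq_card_weighted` with masks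
  replaced by weights: only the CELL CORRELATION of the weight against the slice at the origin is seen).
* §2 **`sum_box_prod_slot`** — coordinate factorisation of `Σ_{r ∈ box} Π_{s ∈ S} f_s (r_{δ s} + e_s)` (p2 g25's `PeriodicKKTExchangePairing.sum_box_mul_coord`
  pattern, any finite slot set); **`sum_box_prod_slot_eq_zero_of_lonely`** — a slot reading a coordinate no other slot reads, with vanishing window sums, kills it.
* §3 `sum_range_sawGrad` (`Σ_{m<N} (1 − N·[(m+e′) % N = N−1]) = 0`, every offset; `FourFaceOneCov.card_filter_range_emod_succ`), `abs_sawGrad_le`, `abs_prod_sawGrad_le`.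
* §4 `pow_four_mul_ite_eq_sum_powerset` (inclusion–exclusion for four face indicators, `Finset.prod_add`), **`fourFace_mul_eq_sum_sectors`** — THE SECTOR
  EXPANSION with p2's literal `if … % N = N − 1 ∧ … then Y … else 0` four-face form on the left (`1 ≤ N`):
  `N⁴·Σ_{r∈box}Σ'_{u′xz}[r_κ, u′_{κ′}, x_a, z_b on the exit faces]·Y κ r κ′ u′ x z (inl α)(inl β)
   = Σ_{S ⊆ {0,1,2,3}} (−1)^{|S|}·Σ_{r∈box}Σ'_{u′xz} (Π_{s∈S} (1 − N·[slot_s (δ_s) % N = N−1]))·Y κ r κ′ u′ x z (inl α)(inl β)`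
  (slots `(r, u′, x, z) = ![toSite r, u′, x, z]`, directions `δ = ![κ, κ′, a, b]`); **`sector_empty`** (`Sector_∅ = zmode N Y κ κ′ (inl α) (inl β)`);
  **`sector_eq_zero_of_lonely`** (`s₀ ∈ S` with `δ_s = δ_{s₀} ⇒ s = s₀` on `S` ⟹ `Sector_S = 0`).
READING for (C)_j (docstring level; with p2's `zfreeSym_sourceB_iff`): `zmodeSym(b̃_j) = −λ̂·Σ_{S live, S ≠ ∅} (−1)^{|S|}·(Sector_S(T̃_j)(μν) + Sector_S(T̃_j)(νμ))`
— the source's symmetrised charge against the LIVE sectors only; NOT asserted here.  HONEST FRAMING (cell contract, verbatim): «discharging `BetaPertH` makes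
Bałaban's UV stability UNCONDITIONAL — a real constructive-QFT result; it is NOT the continuum limit and NOT the Clay problem.»  HONEST DEPENDENCY (verbatim):
«continuum YM on T⁴ ⇐ BetaPertH ∧ nine spine estimates (0/9 proved); BetaPertH ⇐ (D1) ∧ (D4) ∧ CAP+tail; G-an2-4 gates asym, D1 and NE2/3/4.»  Bookkeeping
only: NO Ward content, NO estimate of Bałaban's; discharges NOTHING of (C) ∕ (C)sym ∕ (Q-L) ∕ «T2Shape» ∕ «T2Drift» ∕ (hW, hWall); 0 wall binders; NEVER
«G-an2-4 closed» as (CONV-C); NOT D1, NOT BetaPertH, NOT continuum, NOT Clay.  2026-08-23.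
-/

noncomputable section

open Finset
open scoped BigOperators
open Literature.MathematicalPhysics.QuantumFieldTheory
open Literature.MathematicalPhysics.QuantumFieldTheory.Balaban1983to89
open Literature.MathematicalPhysics.QuantumFieldTheory.Balaban1983to89.Beta
open ExpKernelCalculus (MKer shiftK)
open AffineAveraging (Site box toSite)
open OneStepResolventKernel (Fib)
open BalabanCompositeJets (LocStencil₂)
open Summit.QuantumFields.BalabanUV.Beta.GAN24.BiStencilZeroMode (Tab zmode)
open Summit.QuantumFields.BalabanUV.Beta.GAN24.TaylorBlockSum (card_box)
open Summit.QuantumFields.BalabanUV.Beta.GAN24.TableDressingZeroMode (summable_triple)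
open Summit.QuantumFields.BalabanUV.Beta.GAN24.FourFaceOneCov (card_filter_range_emod_succ)

namespace Summit.QuantumFields.BalabanUV.Beta.GAN24.FourFaceGaugeSectors

variable {d : ℕ} {N : ℕ}

/-! ## §1 The weighted slice formula: a cell-summed weighted charge of a unit-covariant table is a cell-correlation-weighted slice at the origin -/

/-- [folklore] **MOVING THE FIRST BOND TO THE ORIGIN UNDER A WEIGHT** (ff block unit-covariant; three re-indexings by `+s`, no summability needed):
`Σ'_{u′} Σ'_x Σ'_z w u′ x z·Y κ s κ′ u′ x z (inl α) (inl β) = Σ'_{u′} Σ'_x Σ'_z w (u′+s) (x+s) (z+s)·Y κ 0 κ′ u′ x z (inl α) (inl β)`. -/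
theorem tsum3_weight_shift {Y : Tab d}
    (h1 : ∀ κ u κ' u' (t x z : Site (d + 1)) (α β : Fin (d + 1)),
      Y κ (u + t) κ' (u' + t) x z (Sum.inl α) (Sum.inl β) = shiftK (-t) (Y κ u κ' u') x z (Sum.inl α) (Sum.inl β))
    (w : Site (d + 1) → Site (d + 1) → Site (d + 1) → ℝ) (κ κ' α β : Fin (d + 1)) (s : Site (d + 1)) :
    (∑' u' : Site (d + 1), ∑' x : Site (d + 1), ∑' z : Site (d + 1), w u' x z * Y κ s κ' u' x z (Sum.inl α) (Sum.inl β))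
      = ∑' u' : Site (d + 1), ∑' x : Site (d + 1), ∑' z : Site (d + 1),
          w (u' + s) (x + s) (z + s) * Y κ 0 κ' u' x z (Sum.inl α) (Sum.inl β) := by
  have hY : ∀ u' x z : Site (d + 1), Y κ s κ' (u' + s) (x + s) (z + s) (Sum.inl α) (Sum.inl β) = Y κ 0 κ' u' x z (Sum.inl α) (Sum.inl β) := by
    intro u' x z
    have h := h1 κ 0 κ' u' s (x + s) (z + s) α β
    rw [zero_add] at h
    rw [h]
    simp only [shiftK, add_neg_cancel_right]
  rw [← (Equiv.addRight s).tsum_eq (fun u' : Site (d + 1) => ∑' x : Site (d + 1), ∑' z : Site (d + 1),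
      w u' x z * Y κ s κ' u' x z (Sum.inl α) (Sum.inl β))]
  refine tsum_congr fun u' => ?_
  simp only [Equiv.coe_addRight]
  rw [← (Equiv.addRight s).tsum_eq (fun x : Site (d + 1) => ∑' z : Site (d + 1),
      w (u' + s) x z * Y κ s κ' (u' + s) x z (Sum.inl α) (Sum.inl β))]
  refine tsum_congr fun x => ?_
  simp only [Equiv.coe_addRight]
  rw [← (Equiv.addRight s).tsum_eq (fun z : Site (d + 1) =>
      w (u' + s) (x + s) z * Y κ s κ' (u' + s) (x + s) z (Sum.inl α) (Sum.inl β))]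
  refine tsum_congr fun z => ?_
  simp only [Equiv.coe_addRight, hY]

/-- [folklore] A bounded weight against the slice at the origin is summable on the product lattice (`LocStencil₂ Y C δ`, `0 < δ`; weight bounded by `B`). -/
theorem summable_weight_slice {Y : Tab d} {C δ : ℝ} (hY : LocStencil₂ Y C δ) (hδ : 0 < δ)
    {W : Site (d + 1) × (Site (d + 1) × Site (d + 1)) → ℝ} {B : ℝ} (hW : ∀ p, |W p| ≤ B) (κ κ' : Fin (d + 1)) (a b : Fib d) :
    Summable fun p : Site (d + 1) × (Site (d + 1) × Site (d + 1)) => W p * Y κ 0 κ' p.1 p.2.1 p.2.2 a b := by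
  refine Summable.of_norm_bounded ((summable_triple hY hδ κ 0 κ' a b).abs.mul_left B) fun p => ?_
  rw [Real.norm_eq_abs, abs_mul]
  exact mul_le_mul_of_nonneg_right (hW p) (abs_nonneg _)

/-- NOT IN PRINT; OUR BOOKKEEPING.  **THE WEIGHTED SLICE FORMULA, PRODUCT FORM** (`LocStencil₂ Y C δ`, `0 < δ`, ff block unit-covariant; cell-indexed weights `w rr`
bounded by `B`): `Σ_{rr ∈ box} Σ'_{u′} Σ'_x Σ'_z w rr u′ x z·Y κ (toSite rr) κ′ u′ x z (inl α) (inl β) = Σ'_{(u′,x,z)} (Σ_{rr ∈ box} w rr (u′ + toSite rr) (x + toSite rr)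
(z + toSite rr))·Y κ 0 κ′ u′ x z (inl α) (inl β)` — only the CELL CORRELATION of the weight against the slice at the origin is seen. -/
theorem weighted_eq_tsum_prod (N : ℕ) {Y : Tab d} {C δ : ℝ} (hY : LocStencil₂ Y C δ) (hδ : 0 < δ)
    (h1 : ∀ κ u κ' u' (t x z : Site (d + 1)) (α β : Fin (d + 1)),
      Y κ (u + t) κ' (u' + t) x z (Sum.inl α) (Sum.inl β) = shiftK (-t) (Y κ u κ' u') x z (Sum.inl α) (Sum.inl β))
    {w : (Fin (d + 1) → ℕ) → Site (d + 1) → Site (d + 1) → Site (d + 1) → ℝ} {B : ℝ} (hw : ∀ rr u' x z, |w rr u' x z| ≤ B)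
    (κ κ' α β : Fin (d + 1)) :
    ∑ rr ∈ box (d + 1) N, ∑' u' : Site (d + 1), ∑' x : Site (d + 1), ∑' z : Site (d + 1), w rr u' x z * Y κ (toSite rr) κ' u' x z (Sum.inl α) (Sum.inl β)
      = ∑' p : Site (d + 1) × (Site (d + 1) × Site (d + 1)),
          (∑ rr ∈ box (d + 1) N, w rr (p.1 + toSite rr) (p.2.1 + toSite rr) (p.2.2 + toSite rr)) * Y κ 0 κ' p.1 p.2.1 p.2.2 (Sum.inl α) (Sum.inl β) := by
  -- move every first bond to the origin
  rw [Finset.sum_congr rfl fun rr _ => tsum3_weight_shift h1 (w rr) κ κ' α β (toSite rr)]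
  -- the shifted weighted triples are summable on the product, cell by cell
  set F : (Fin (d + 1) → ℕ) → Site (d + 1) × (Site (d + 1) × Site (d + 1)) → ℝ := fun rr p =>
    w rr (p.1 + toSite rr) (p.2.1 + toSite rr) (p.2.2 + toSite rr) * Y κ 0 κ' p.1 p.2.1 p.2.2 (Sum.inl α) (Sum.inl β) with hF
  have hFs : ∀ rr, Summable (F rr) := fun rr =>
    summable_weight_slice hY hδ (W := fun p => w rr (p.1 + toSite rr) (p.2.1 + toSite rr) (p.2.2 + toSite rr)) (fun p => hw rr _ _ _) κ κ' _ _
  have eP : ∀ rr, (∑' u' : Site (d + 1), ∑' x : Site (d + 1), ∑' z : Site (d + 1),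
        w rr (u' + toSite rr) (x + toSite rr) (z + toSite rr) * Y κ 0 κ' u' x z (Sum.inl α) (Sum.inl β)) = ∑' p, F rr p := by
    intro rr
    rw [(hFs rr).tsum_prod]
    refine tsum_congr fun u' => ?_
    exact ((hFs rr).prod_factor u').tsum_prod.symm
  simp_rw [eP]
  rw [← Summable.tsum_finsetSum fun rr _ => hFs rr]
  refine tsum_congr fun p => ?_
  simp only [hF, Finset.sum_mul]

/-- NOT IN PRINT; OUR BOOKKEEPING.  **THE WEIGHTED SLICE FORMULA, ITERATED FORM** (the same with the right-hand side as the iterated triple series; my g52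
`FourFaceOneCov.fourFace_eq_card_weighted` with indicator masks replaced by bounded weights). -/
theorem weighted_eq_cellCorr_slice (N : ℕ) {Y : Tab d} {C δ : ℝ} (hY : LocStencil₂ Y C δ) (hδ : 0 < δ)
    (h1 : ∀ κ u κ' u' (t x z : Site (d + 1)) (α β : Fin (d + 1)),
      Y κ (u + t) κ' (u' + t) x z (Sum.inl α) (Sum.inl β) = shiftK (-t) (Y κ u κ' u') x z (Sum.inl α) (Sum.inl β))
    {w : (Fin (d + 1) → ℕ) → Site (d + 1) → Site (d + 1) → Site (d + 1) → ℝ} {B : ℝ} (hw : ∀ rr u' x z, |w rr u' x z| ≤ B)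
    (κ κ' α β : Fin (d + 1)) :
    ∑ rr ∈ box (d + 1) N, ∑' u' : Site (d + 1), ∑' x : Site (d + 1), ∑' z : Site (d + 1), w rr u' x z * Y κ (toSite rr) κ' u' x z (Sum.inl α) (Sum.inl β)
      = ∑' u' : Site (d + 1), ∑' x : Site (d + 1), ∑' z : Site (d + 1),
          (∑ rr ∈ box (d + 1) N, w rr (u' + toSite rr) (x + toSite rr) (z + toSite rr)) * Y κ 0 κ' u' x z (Sum.inl α) (Sum.inl β) := by
  rw [weighted_eq_tsum_prod N hY hδ h1 hw κ κ' α β]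
  have hB : ∀ p : Site (d + 1) × (Site (d + 1) × Site (d + 1)),
      |∑ rr ∈ box (d + 1) N, w rr (p.1 + toSite rr) (p.2.1 + toSite rr) (p.2.2 + toSite rr)| ≤ ((box (d + 1) N).card : ℝ) * B := by
    intro p
    calc |∑ rr ∈ box (d + 1) N, w rr (p.1 + toSite rr) (p.2.1 + toSite rr) (p.2.2 + toSite rr)|
        ≤ ∑ rr ∈ box (d + 1) N, |w rr (p.1 + toSite rr) (p.2.1 + toSite rr) (p.2.2 + toSite rr)| := Finset.abs_sum_le_sum_abs _ _
      _ ≤ ∑ rr ∈ box (d + 1) N, B := Finset.sum_le_sum fun rr _ => hw rr _ _ _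
      _ = ((box (d + 1) N).card : ℝ) * B := by rw [Finset.sum_const, nsmul_eq_mul]
  have hGs := summable_weight_slice hY hδ hB κ κ' (Sum.inl α) (Sum.inl β)
  rw [hGs.tsum_prod]
  refine tsum_congr fun u' => ?_
  exact (hGs.prod_factor u').tsum_prod

/-! ## §2 Coordinate factorisation of the cell sum of a product of one-coordinate slot weights; the lonely direction -/

/-- [folklore] **COORDINATE FACTORISATION**: a cell sum of a product of slot weights, each reading ONE coordinate `δ s` of the cell point (shifted by `e s`),
is the product over the coordinates of the window sums of the weights reading that coordinate (`Finset.sum_prod_piFinset` after sorting the slots by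
coordinate, p2's `PeriodicKKTExchangePairing.sum_box_mul_coord` pattern). -/
theorem sum_box_prod_slot {ι : Type*} (S : Finset ι) (δ : ι → Fin (d + 1)) (e : ι → ℤ) (f : ι → ℤ → ℝ) (N : ℕ) :
    ∑ rr ∈ box (d + 1) N, ∏ s ∈ S, f s ((rr (δ s) : ℤ) + e s)
      = ∏ i : Fin (d + 1), ∑ m ∈ Finset.range N, ∏ s ∈ S.filter (fun s => δ s = i), f s ((m : ℤ) + e s) := by
  have hfib : ∀ rr : Fin (d + 1) → ℕ, ∏ s ∈ S, f s ((rr (δ s) : ℤ) + e s)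
      = ∏ i : Fin (d + 1), ∏ s ∈ S.filter (fun s => δ s = i), f s ((rr i : ℤ) + e s) := by
    intro rr
    rw [← Finset.prod_fiberwise_of_maps_to (s := S) (t := Finset.univ) (g := δ) (fun s _ => Finset.mem_univ (δ s))]
    refine Finset.prod_congr rfl fun i _ => Finset.prod_congr rfl fun s hs => ?_
    rw [(Finset.mem_filter.1 hs).2]
  simp_rw [hfib]
  rw [show box (d + 1) N = Fintype.piFinset (fun _ => Finset.range N) from rfl]
  exact Finset.sum_prod_piFinset (Finset.range N) (fun i (m : ℕ) => ∏ s ∈ S.filter (fun s => δ s = i), f s ((m : ℤ) + e s))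

/-- [folklore] **THE LONELY DIRECTION**: if some slot `s₀ ∈ S` reads a coordinate that no other slot of `S` reads, and its weight has vanishing window sums
(`Σ_{m<N} f s₀ (m + e′) = 0` for every offset `e′`), the cell sum of the product weight VANISHES. -/
theorem sum_box_prod_slot_eq_zero_of_lonely {ι : Type*} (S : Finset ι) (δ : ι → Fin (d + 1)) (e : ι → ℤ) (f : ι → ℤ → ℝ) (N : ℕ)
    {s₀ : ι} (hs₀ : s₀ ∈ S) (hlone : ∀ s ∈ S, δ s = δ s₀ → s = s₀) (hf : ∀ e' : ℤ, ∑ m ∈ Finset.range N, f s₀ ((m : ℤ) + e') = 0) :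
    ∑ rr ∈ box (d + 1) N, ∏ s ∈ S, f s ((rr (δ s) : ℤ) + e s) = 0 := by
  rw [sum_box_prod_slot]
  refine Finset.prod_eq_zero (Finset.mem_univ (δ s₀)) ?_
  have hS : S.filter (fun s => δ s = δ s₀) = {s₀} := by
    ext s
    simp only [Finset.mem_filter, Finset.mem_singleton]
    exact ⟨fun h => hlone s h.1 h.2, fun h => by subst h; exact ⟨hs₀, rfl⟩⟩
  rw [hS]
  simp only [Finset.prod_singleton]
  exact hf (e s₀)

/-! ## §3 The block sawtooth's gradient: all window sums vanish -/

/-- [folklore] **THE SAWTOOTH GRADIENT HAS VANISHING WINDOW SUMS** (`1 ≤ N`): `Σ_{m<N} (1 − N·[(m + e′) % N = N − 1]) = N − N·1 = 0` — exactly one residue in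
every window of length `N` sits on the exit face (`FourFaceOneCov.card_filter_range_emod_succ`).  (`1 − N·[w_δ % N = N−1] = (dλ_δ)_δ (w)` for the zero-mean block
sawtooth `λ_δ`; `N·𝟙_{exit face} = 1 − (dλ_δ)_δ` is (Z2) `Π_bm c̃_δ = c̃_δ − dλ_δ` in components.) -/
theorem sum_range_sawGrad (hN : 1 ≤ N) (e' : ℤ) :
    ∑ m ∈ Finset.range N, (1 - (N : ℝ) * (if ((m : ℤ) + e') % (N : ℤ) = (N : ℤ) - 1 then (1 : ℝ) else 0)) = 0 := by
  rw [Finset.sum_sub_distrib, Finset.sum_const, Finset.card_range, nsmul_eq_mul, mul_one, ← Finset.mul_sum, Finset.sum_boole,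
    card_filter_range_emod_succ hN e']
  push_cast
  ring

/-- [folklore] The sawtooth gradient is bounded by `N` (`1 ≤ N`). -/
theorem abs_sawGrad_le (hN : 1 ≤ N) (m : ℤ) :
    |1 - (N : ℝ) * (if m % (N : ℤ) = (N : ℤ) - 1 then (1 : ℝ) else 0)| ≤ N := by
  have hN' : (1 : ℝ) ≤ N := by exact_mod_cast hN
  split_ifs
  · rw [mul_one, abs_sub_comm, abs_of_nonneg (by linarith)]
    linarith
  · rw [mul_zero, sub_zero, abs_one]
    exact hN'

/-- [folklore] A product of sawtooth-gradient slot weights over `S ⊆ Fin 4` is bounded by `N⁴` (`1 ≤ N`). -/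
theorem abs_prod_sawGrad_le (hN : 1 ≤ N) (S : Finset (Fin 4)) (m : Fin 4 → ℤ) :
    |∏ s ∈ S, (1 - (N : ℝ) * (if m s % (N : ℤ) = (N : ℤ) - 1 then (1 : ℝ) else 0))| ≤ (N : ℝ) ^ 4 := by
  have hN' : (1 : ℝ) ≤ N := by exact_mod_cast hN
  rw [Finset.abs_prod]
  calc ∏ s ∈ S, |1 - (N : ℝ) * (if m s % (N : ℤ) = (N : ℤ) - 1 then (1 : ℝ) else 0)|
      ≤ ∏ _s ∈ S, (N : ℝ) := Finset.prod_le_prod (fun _ _ => abs_nonneg _) fun s _ => abs_sawGrad_le hN (m s)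
    _ = (N : ℝ) ^ S.card := Finset.prod_const _
    _ ≤ (N : ℝ) ^ 4 := by
        refine pow_le_pow_right₀ hN' ?_
        have := Finset.card_le_univ S
        simpa using this

/-! ## §4 The sector expansion of the four-face charge and the vanishing of the lonely sectors -/

/-- [folklore] **INCLUSION–EXCLUSION FOR FOUR FACE INDICATORS**: `N⁴·[m₀, m₁, m₂, m₃ on the exit faces] = Σ_{S ⊆ {0,1,2,3}} (−1)^{|S|}·Π_{s ∈ S} (1 − N·[m_s on the face])`
(`N·𝟙 = 1 − φ` slot by slot, then `Finset.prod_add` over the four slots). -/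
theorem pow_four_mul_ite_eq_sum_powerset (N : ℕ) (m : Fin 4 → ℤ) :
    (N : ℝ) ^ 4 * (if (m 0 % (N : ℤ) = (N : ℤ) - 1 ∧ m 1 % (N : ℤ) = (N : ℤ) - 1 ∧ m 2 % (N : ℤ) = (N : ℤ) - 1 ∧ m 3 % (N : ℤ) = (N : ℤ) - 1)
        then (1 : ℝ) else 0)
      = ∑ S ∈ (Finset.univ : Finset (Fin 4)).powerset,
          (-1 : ℝ) ^ S.card * ∏ s ∈ S, (1 - (N : ℝ) * (if m s % (N : ℤ) = (N : ℤ) - 1 then (1 : ℝ) else 0)) := by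
  -- the indicator of the conjunction is the product of the four indicators
  have e1 : (N : ℝ) ^ 4 * (if (m 0 % (N : ℤ) = (N : ℤ) - 1 ∧ m 1 % (N : ℤ) = (N : ℤ) - 1 ∧ m 2 % (N : ℤ) = (N : ℤ) - 1 ∧ m 3 % (N : ℤ) = (N : ℤ) - 1)
        then (1 : ℝ) else 0)
      = ∏ s : Fin 4, ((N : ℝ) * (if m s % (N : ℤ) = (N : ℤ) - 1 then (1 : ℝ) else 0)) := by
    rw [Fin.prod_univ_four]
    by_cases h0 : m 0 % (N : ℤ) = (N : ℤ) - 1 <;> by_cases h1 : m 1 % (N : ℤ) = (N : ℤ) - 1 <;>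
      by_cases h2 : m 2 % (N : ℤ) = (N : ℤ) - 1 <;> by_cases h3 : m 3 % (N : ℤ) = (N : ℤ) - 1 <;> simp [h0, h1, h2, h3, pow_succ, mul_assoc]
  -- `N·𝟙 = (−φ) + 1` slot by slot, then expand the product of binomials over the powerset
  have e2 : ∏ s : Fin 4, ((N : ℝ) * (if m s % (N : ℤ) = (N : ℤ) - 1 then (1 : ℝ) else 0))
      = ∏ s : Fin 4, (-(1 - (N : ℝ) * (if m s % (N : ℤ) = (N : ℤ) - 1 then (1 : ℝ) else 0)) + 1) :=
    Finset.prod_congr rfl fun s _ => by ring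
  rw [e1, e2, Finset.prod_add]
  refine Finset.sum_congr rfl fun S _ => ?_
  rw [Finset.prod_const_one, mul_one]
  have e3 : ∀ s ∈ S, -(1 - (N : ℝ) * (if m s % (N : ℤ) = (N : ℤ) - 1 then (1 : ℝ) else 0))
      = (-1 : ℝ) * (1 - (N : ℝ) * (if m s % (N : ℤ) = (N : ℤ) - 1 then (1 : ℝ) else 0)) := fun s _ => by ring
  rw [Finset.prod_congr rfl e3, Finset.prod_mul_distrib, Finset.prod_const]

/-- [folklore] The alternating sum of the sector weights is bounded by `2⁴·N⁴` (`1 ≤ N`). -/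
theorem abs_sum_powerset_prod_sawGrad_le (hN : 1 ≤ N) (m : Fin 4 → ℤ) :
    |∑ S ∈ (Finset.univ : Finset (Fin 4)).powerset,
        (-1 : ℝ) ^ S.card * ∏ s ∈ S, (1 - (N : ℝ) * (if m s % (N : ℤ) = (N : ℤ) - 1 then (1 : ℝ) else 0))| ≤ 2 ^ 4 * (N : ℝ) ^ 4 := by
  calc |∑ S ∈ (Finset.univ : Finset (Fin 4)).powerset,
          (-1 : ℝ) ^ S.card * ∏ s ∈ S, (1 - (N : ℝ) * (if m s % (N : ℤ) = (N : ℤ) - 1 then (1 : ℝ) else 0))|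
      ≤ ∑ S ∈ (Finset.univ : Finset (Fin 4)).powerset,
          |(-1 : ℝ) ^ S.card * ∏ s ∈ S, (1 - (N : ℝ) * (if m s % (N : ℤ) = (N : ℤ) - 1 then (1 : ℝ) else 0))| :=
        Finset.abs_sum_le_sum_abs _ _
    _ ≤ ∑ _S ∈ (Finset.univ : Finset (Fin 4)).powerset, (N : ℝ) ^ 4 := Finset.sum_le_sum fun S _ => by
        rw [abs_mul, abs_pow, abs_neg, abs_one, one_pow, one_mul]
        exact abs_prod_sawGrad_le hN S m
    _ = 2 ^ 4 * (N : ℝ) ^ 4 := by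
        rw [Finset.sum_const, Finset.card_powerset, Finset.card_univ, Fintype.card_fin, nsmul_eq_mul]
        norm_num

/-- NOT IN PRINT; OUR BOOKKEEPING.  **THE FOUR-FACE CHARGE OF A UNIT-COVARIANT TABLE IN PURE-GAUGE SECTORS** (`1 ≤ N`; `Y : Tab d` with `LocStencil₂ Y C δ`, `0 < δ`,
whose field–field block is covariant under ALL unit translations; any face directions `κ κ′ a b` of the four slots `(r, u′, x, z)`, any fibre entries `α β`):
`N⁴ · Σ_{r ∈ box} Σ'_{u′} Σ'_x Σ'_z [r_κ, u′_{κ′}, x_a, z_b ≡ N−1 (mod N)]·Y κ r κ′ u′ x z (inl α) (inl β)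
   = Σ_{S ⊆ {0,1,2,3}} (−1)^{|S|} · Σ_{r ∈ box} Σ'_{u′} Σ'_x Σ'_z (Π_{s ∈ S} (1 − N·[slot_s on its exit face]))·Y κ r κ′ u′ x z (inl α) (inl β)`
— p2's literal four-face form (`T2RecChargeStepFourFace.zmode_succ_eq_fourFace`) on the left; on the right the PURE-GAUGE SECTORS: the slot weight
`1 − N·[w_δ % N = N−1]` is the `δ`-component of the gradient `dλ_δ` of the zero-mean block sawtooth ((Z2) `Π_bm c̃_δ = c̃_δ − dλ_δ`, `N·𝟙_{exit face} = c̃ − dλ`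
in components), so `Sector_S` is the table contracted with the pure gauges `dλ` in the slots of `S` and the constants `c̃` elsewhere (`Sector_∅ = zmode N Y`:
`sector_empty`).  The LONELY sectors vanish (`sector_eq_zero_of_lonely`). -/
theorem fourFace_mul_eq_sum_sectors (hN : 1 ≤ N) {Y : Tab d} {C δ : ℝ} (hY : LocStencil₂ Y C δ) (hδ : 0 < δ)
    (h1 : ∀ κ u κ' u' (t x z : Site (d + 1)) (α β : Fin (d + 1)),
      Y κ (u + t) κ' (u' + t) x z (Sum.inl α) (Sum.inl β) = shiftK (-t) (Y κ u κ' u') x z (Sum.inl α) (Sum.inl β))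
    (κ κ' a b α β : Fin (d + 1)) :
    (N : ℝ) ^ 4 * ∑ rr ∈ box (d + 1) N, ∑' u' : Site (d + 1), ∑' x : Site (d + 1), ∑' z : Site (d + 1),
        (if toSite rr κ % (N : ℤ) = (N : ℤ) - 1 ∧ u' κ' % (N : ℤ) = (N : ℤ) - 1 ∧ x a % (N : ℤ) = (N : ℤ) - 1 ∧ z b % (N : ℤ) = (N : ℤ) - 1
          then Y κ (toSite rr) κ' u' x z (Sum.inl α) (Sum.inl β) else 0)
      = ∑ S ∈ (Finset.univ : Finset (Fin 4)).powerset, (-1 : ℝ) ^ S.card *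
          ∑ rr ∈ box (d + 1) N, ∑' u' : Site (d + 1), ∑' x : Site (d + 1), ∑' z : Site (d + 1),
            (∏ s ∈ S, (1 - (N : ℝ) * (if (![toSite rr, u', x, z] : Fin 4 → Site (d + 1)) s ((![κ, κ', a, b] : Fin 4 → Fin (d + 1)) s) % (N : ℤ) = (N : ℤ) - 1
              then (1 : ℝ) else 0))) * Y κ (toSite rr) κ' u' x z (Sum.inl α) (Sum.inl β) := by
  -- Step 1: the left-hand side in weighted form, pointwise by inclusion–exclusion
  have ept : ∀ (rr : Fin (d + 1) → ℕ) (u' x z : Site (d + 1)),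
      (N : ℝ) ^ 4 * (if toSite rr κ % (N : ℤ) = (N : ℤ) - 1 ∧ u' κ' % (N : ℤ) = (N : ℤ) - 1 ∧ x a % (N : ℤ) = (N : ℤ) - 1 ∧ z b % (N : ℤ) = (N : ℤ) - 1
          then Y κ (toSite rr) κ' u' x z (Sum.inl α) (Sum.inl β) else 0)
        = (∑ S ∈ (Finset.univ : Finset (Fin 4)).powerset, (-1 : ℝ) ^ S.card *
            ∏ s ∈ S, (1 - (N : ℝ) * (if (![toSite rr, u', x, z] : Fin 4 → Site (d + 1)) s ((![κ, κ', a, b] : Fin 4 → Fin (d + 1)) s) % (N : ℤ) = (N : ℤ) - 1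
              then (1 : ℝ) else 0))) * Y κ (toSite rr) κ' u' x z (Sum.inl α) (Sum.inl β) := by
    intro rr u' x z
    rw [← pow_four_mul_ite_eq_sum_powerset N (fun s => (![toSite rr, u', x, z] : Fin 4 → Site (d + 1)) s ((![κ, κ', a, b] : Fin 4 → Fin (d + 1)) s))]
    simp only [Matrix.cons_val_zero, Matrix.cons_val_one, Matrix.cons_val_two, Matrix.cons_val_three, Matrix.head_cons, Matrix.tail_cons]
    split_ifs <;> simp
  have eL : (N : ℝ) ^ 4 * ∑ rr ∈ box (d + 1) N, ∑' u' : Site (d + 1), ∑' x : Site (d + 1), ∑' z : Site (d + 1),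
        (if toSite rr κ % (N : ℤ) = (N : ℤ) - 1 ∧ u' κ' % (N : ℤ) = (N : ℤ) - 1 ∧ x a % (N : ℤ) = (N : ℤ) - 1 ∧ z b % (N : ℤ) = (N : ℤ) - 1
          then Y κ (toSite rr) κ' u' x z (Sum.inl α) (Sum.inl β) else 0)
      = ∑ rr ∈ box (d + 1) N, ∑' u' : Site (d + 1), ∑' x : Site (d + 1), ∑' z : Site (d + 1),
        (∑ S ∈ (Finset.univ : Finset (Fin 4)).powerset, (-1 : ℝ) ^ S.card *
            ∏ s ∈ S, (1 - (N : ℝ) * (if (![toSite rr, u', x, z] : Fin 4 → Site (d + 1)) s ((![κ, κ', a, b] : Fin 4 → Fin (d + 1)) s) % (N : ℤ) = (N : ℤ) - 1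
              then (1 : ℝ) else 0))) * Y κ (toSite rr) κ' u' x z (Sum.inl α) (Sum.inl β) := by
    rw [Finset.mul_sum]
    refine Finset.sum_congr rfl fun rr _ => ?_
    rw [← tsum_mul_left]
    refine tsum_congr fun u' => ?_
    rw [← tsum_mul_left]
    refine tsum_congr fun x => ?_
    rw [← tsum_mul_left]
    exact tsum_congr fun z => ept rr u' x z
  rw [eL]
  -- Step 2: both sides in product form against the slice at the origin
  rw [weighted_eq_tsum_prod N hY hδ h1 (B := 2 ^ 4 * (N : ℝ) ^ 4)
    (fun rr u' x z => abs_sum_powerset_prod_sawGrad_le hN (fun s => (![toSite rr, u', x, z] : Fin 4 → Site (d + 1)) s ((![κ, κ', a, b] : Fin 4 → Fin (d + 1)) s)))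
    κ κ' α β]
  have eS : ∀ S ∈ (Finset.univ : Finset (Fin 4)).powerset,
      (-1 : ℝ) ^ S.card * ∑ rr ∈ box (d + 1) N, ∑' u' : Site (d + 1), ∑' x : Site (d + 1), ∑' z : Site (d + 1),
          (∏ s ∈ S, (1 - (N : ℝ) * (if (![toSite rr, u', x, z] : Fin 4 → Site (d + 1)) s ((![κ, κ', a, b] : Fin 4 → Fin (d + 1)) s) % (N : ℤ) = (N : ℤ) - 1
            then (1 : ℝ) else 0))) * Y κ (toSite rr) κ' u' x z (Sum.inl α) (Sum.inl β)
        = ∑' p : Site (d + 1) × (Site (d + 1) × Site (d + 1)), (-1 : ℝ) ^ S.card *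
            ((∑ rr ∈ box (d + 1) N, ∏ s ∈ S, (1 - (N : ℝ) *
              (if (![toSite rr, p.1 + toSite rr, p.2.1 + toSite rr, p.2.2 + toSite rr] : Fin 4 → Site (d + 1)) s ((![κ, κ', a, b] : Fin 4 → Fin (d + 1)) s)
                % (N : ℤ) = (N : ℤ) - 1 then (1 : ℝ) else 0))) * Y κ 0 κ' p.1 p.2.1 p.2.2 (Sum.inl α) (Sum.inl β)) := by
    intro S _
    rw [weighted_eq_tsum_prod N hY hδ h1 (B := (N : ℝ) ^ 4)
      (fun rr u' x z => abs_prod_sawGrad_le hN S (fun s => (![toSite rr, u', x, z] : Fin 4 → Site (d + 1)) s ((![κ, κ', a, b] : Fin 4 → Fin (d + 1)) s)))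
      κ κ' α β, tsum_mul_left]
  rw [Finset.sum_congr rfl eS]
  have hSs : ∀ S ∈ (Finset.univ : Finset (Fin 4)).powerset, Summable fun p : Site (d + 1) × (Site (d + 1) × Site (d + 1)) => (-1 : ℝ) ^ S.card *
      ((∑ rr ∈ box (d + 1) N, ∏ s ∈ S, (1 - (N : ℝ) *
        (if (![toSite rr, p.1 + toSite rr, p.2.1 + toSite rr, p.2.2 + toSite rr] : Fin 4 → Site (d + 1)) s ((![κ, κ', a, b] : Fin 4 → Fin (d + 1)) s)
          % (N : ℤ) = (N : ℤ) - 1 then (1 : ℝ) else 0))) * Y κ 0 κ' p.1 p.2.1 p.2.2 (Sum.inl α) (Sum.inl β)) := by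
    intro S _
    refine (summable_weight_slice hY hδ (B := ((box (d + 1) N).card : ℝ) * (N : ℝ) ^ 4) (fun p => ?_) κ κ' (Sum.inl α) (Sum.inl β)).mul_left _
    calc |∑ rr ∈ box (d + 1) N, ∏ s ∈ S, (1 - (N : ℝ) *
            (if (![toSite rr, p.1 + toSite rr, p.2.1 + toSite rr, p.2.2 + toSite rr] : Fin 4 → Site (d + 1)) s ((![κ, κ', a, b] : Fin 4 → Fin (d + 1)) s)
              % (N : ℤ) = (N : ℤ) - 1 then (1 : ℝ) else 0))|
        ≤ ∑ rr ∈ box (d + 1) N, |∏ s ∈ S, (1 - (N : ℝ) *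
            (if (![toSite rr, p.1 + toSite rr, p.2.1 + toSite rr, p.2.2 + toSite rr] : Fin 4 → Site (d + 1)) s ((![κ, κ', a, b] : Fin 4 → Fin (d + 1)) s)
              % (N : ℤ) = (N : ℤ) - 1 then (1 : ℝ) else 0))| := Finset.abs_sum_le_sum_abs _ _
      _ ≤ ∑ _rr ∈ box (d + 1) N, (N : ℝ) ^ 4 := Finset.sum_le_sum fun rr _ =>
          abs_prod_sawGrad_le hN S (fun s => (![toSite rr, p.1 + toSite rr, p.2.1 + toSite rr, p.2.2 + toSite rr] : Fin 4 → Site (d + 1)) s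
            ((![κ, κ', a, b] : Fin 4 → Fin (d + 1)) s))
      _ = ((box (d + 1) N).card : ℝ) * (N : ℝ) ^ 4 := by rw [Finset.sum_const, nsmul_eq_mul]
  rw [← Summable.tsum_finsetSum hSs]
  refine tsum_congr fun p => ?_
  rw [Finset.sum_comm, Finset.sum_mul]
  refine Finset.sum_congr rfl fun S _ => ?_
  rw [← Finset.mul_sum]
  ring

/-- NOT IN PRINT; OUR BOOKKEEPING.  **THE EMPTY SECTOR IS THE CELL CHARGE**: `Sector_∅(Y) = zmode N Y κ κ′ (inl α) (inl β)` (`Π_∅ = 1`). -/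
theorem sector_empty (Y : Tab d) (N : ℕ) (κ κ' a b α β : Fin (d + 1)) :
    ∑ rr ∈ box (d + 1) N, ∑' u' : Site (d + 1), ∑' x : Site (d + 1), ∑' z : Site (d + 1),
        (∏ s ∈ (∅ : Finset (Fin 4)), (1 - (N : ℝ) * (if (![toSite rr, u', x, z] : Fin 4 → Site (d + 1)) s ((![κ, κ', a, b] : Fin 4 → Fin (d + 1)) s) % (N : ℤ) = (N : ℤ) - 1
          then (1 : ℝ) else 0))) * Y κ (toSite rr) κ' u' x z (Sum.inl α) (Sum.inl β)
      = zmode N Y κ κ' (Sum.inl α) (Sum.inl β) := by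
  simp only [Finset.prod_empty, one_mul]
  rfl

/-- NOT IN PRINT; OUR BOOKKEEPING.  **EVERY LONELY SECTOR VANISHES** (`1 ≤ N`; `Y` as in `fourFace_mul_eq_sum_sectors`): if some slot `s₀ ∈ S` faces a direction
that no other slot of `S` faces (`(κ, κ′, a, b)_s = (κ, κ′, a, b)_{s₀} ⇒ s = s₀` on `S`), then
`Σ_{r ∈ box} Σ'_{u′} Σ'_x Σ'_z (Π_{s ∈ S} (1 − N·[slot_s on its exit face]))·Y κ r κ′ u′ x z (inl α) (inl β) = 0`.
In particular: every ONE-insertion sector (`S = {s}`), every two-insertion sector across two distinct directions, every three-insertion sector unless its three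
directions coincide — «one pure-gauge insertion never charges the table; mixed pairs vanish» (separation of variables: the cell correlation of the sawtooth
gradients factorises over the coordinates, §2, and a lonely coordinate contributes a vanishing window sum, §3). -/
theorem sector_eq_zero_of_lonely (hN : 1 ≤ N) {Y : Tab d} {C δ : ℝ} (hY : LocStencil₂ Y C δ) (hδ : 0 < δ)
    (h1 : ∀ κ u κ' u' (t x z : Site (d + 1)) (α β : Fin (d + 1)),
      Y κ (u + t) κ' (u' + t) x z (Sum.inl α) (Sum.inl β) = shiftK (-t) (Y κ u κ' u') x z (Sum.inl α) (Sum.inl β))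
    (κ κ' a b α β : Fin (d + 1)) (S : Finset (Fin 4)) {s₀ : Fin 4} (hs₀ : s₀ ∈ S)
    (hlone : ∀ s ∈ S, (![κ, κ', a, b] : Fin 4 → Fin (d + 1)) s = (![κ, κ', a, b] : Fin 4 → Fin (d + 1)) s₀ → s = s₀) :
    ∑ rr ∈ box (d + 1) N, ∑' u' : Site (d + 1), ∑' x : Site (d + 1), ∑' z : Site (d + 1),
        (∏ s ∈ S, (1 - (N : ℝ) * (if (![toSite rr, u', x, z] : Fin 4 → Site (d + 1)) s ((![κ, κ', a, b] : Fin 4 → Fin (d + 1)) s) % (N : ℤ) = (N : ℤ) - 1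
          then (1 : ℝ) else 0))) * Y κ (toSite rr) κ' u' x z (Sum.inl α) (Sum.inl β) = 0 := by
  rw [weighted_eq_cellCorr_slice N hY hδ h1 (B := (N : ℝ) ^ 4)
    (fun rr u' x z => abs_prod_sawGrad_le hN S (fun s => (![toSite rr, u', x, z] : Fin 4 → Site (d + 1)) s ((![κ, κ', a, b] : Fin 4 → Fin (d + 1)) s)))
    κ κ' α β]
  have hW : ∀ u' x z : Site (d + 1), ∑ rr ∈ box (d + 1) N, ∏ s ∈ S, (1 - (N : ℝ) *
      (if (![toSite rr, u' + toSite rr, x + toSite rr, z + toSite rr] : Fin 4 → Site (d + 1)) s ((![κ, κ', a, b] : Fin 4 → Fin (d + 1)) s)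
        % (N : ℤ) = (N : ℤ) - 1 then (1 : ℝ) else 0)) = 0 := by
    intro u' x z
    have e : ∀ (rr : Fin (d + 1) → ℕ) (s : Fin 4),
        (![toSite rr, u' + toSite rr, x + toSite rr, z + toSite rr] : Fin 4 → Site (d + 1)) s ((![κ, κ', a, b] : Fin 4 → Fin (d + 1)) s)
          = (rr ((![κ, κ', a, b] : Fin 4 → Fin (d + 1)) s) : ℤ) + (![(0 : Site (d + 1)), u', x, z] : Fin 4 → Site (d + 1)) s ((![κ, κ', a, b] : Fin 4 → Fin (d + 1)) s) := by
      intro rr s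
      fin_cases s <;> simp [toSite, add_comm]
    rw [Finset.sum_congr rfl fun rr _ => Finset.prod_congr rfl fun s _ => by rw [e rr s]]
    exact sum_box_prod_slot_eq_zero_of_lonely S (![κ, κ', a, b] : Fin 4 → Fin (d + 1))
      (fun s => (![(0 : Site (d + 1)), u', x, z] : Fin 4 → Site (d + 1)) s ((![κ, κ', a, b] : Fin 4 → Fin (d + 1)) s))
      (fun _ m => 1 - (N : ℝ) * (if m % (N : ℤ) = (N : ℤ) - 1 then (1 : ℝ) else 0)) N hs₀ hlone (fun e' => sum_range_sawGrad hN e')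
  simp only [hW, zero_mul, tsum_zero]

end Summit.QuantumFields.BalabanUV.Beta.GAN24.FourFaceGaugeSectors
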